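import Mathlib
import Literature.Computability.AlgebraicComplexity.RazElusiveGeneralProofs
import Summits.ValiantsHypothesis.ValiantsHypothesis.Theorems.SoloInformedQuadSpanReduction
import Summits.ValiantsHypothesis.ValiantsHypothesis.Theorems.SoloInformedPatternDesign
import Summits.ValiantsHypothesis.ValiantsHypothesis.Theorems.SoloInformedQuadSpanClosed
import Summits.ValiantsHypothesis.ValiantsHypothesis.Theorems.SoloInformedReedMullerDesign
import HarnessLib

/-!
# Designs for the window form of Conjecture Q*: parameters and the eventual fit of the
Reed–Muller design (solo seat `solo-ValiantsHypothesis-informed`, s28)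

For an order function `Kf : ℕ → ℕ` with `Kf s ≤ (⌊log₂ s⌋ + 2)^C` eventually, this file fixes the
parameters of the univariate reduction (`SoloInformedQuadSpanReduction`) — `u = ⌊log₂ n⌋`; `τ(n)` =
the largest `τ ≤ u` with `W(τ) = τ + 3(aτ+1) + c((3(aτ+1))!)^b ≤ u`; `ρ = aτ + 1`; `s = n^{2ρ+τ}`;
`L = ⌈log₂ C(n + 3ρ - 1, 3ρ)⌉`; `d = ⌊log_{L+1} n⌋` — and the design family `qwDesign`: the
Reed–Muller design of degree `d` (`SoloInformedReedMullerDesign`; order `2^{d+1} - 1`, every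
height, `(L+1)^d ≤ n` positions) downgraded to order `Kf (s n)` when it fits, the singleton design
with `r = 1` otherwise; proves its Def. 1.3 definability (`qw_isPolyDefinableMap`, empty Boolean
sum) and the EVENTUAL FIT `qw_eventually`: since `(L+1)^{d+1} > n ≥ 2^u` and `L + 1 ≤ (u+1)^2`,
`2^{d+1} > (u+1)^{2C} ≥ Kf (s n)` for all large `n`.  The headline implication is in
`SoloInformedQuadSpanWindow`.  Nothing here is credited toward the summit.
References: R. Raz, Theory of Computing 6 (2010) 135–177, Cor. 5.8, Def. 1.3 [Raz2010].
-/

noncomputable section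

open MvPolynomial Finset

namespace Summit.ValiantsHypothesis.ValiantsHypothesis.Theorems

open Literature.Computability.AlgebraicComplexity

/-- Private points are odd witnesses (count `1`); so `ofOddWitness` generalises
`ofPrivatePoints`. -/
theorem solo_oddWitness_of_privatePoints {K m n : ℕ} (S : Fin m → Finset (Fin n))
    (hS : ∀ T : Finset (Fin m), T.card ≤ K → ∀ i ∈ T, ∃ x ∈ S i, ∀ j ∈ T, j ≠ i → x ∉ S j) :
    ∀ Y : Finset (Fin m), Y.Nonempty → Y.card ≤ K →
      ∃ t : Fin n, Odd (Y.filter fun i => t ∈ S i).card := by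
  classical
  intro Y hY hYK
  obtain ⟨i, hi⟩ := hY
  obtain ⟨x, hx, hpriv⟩ := hS Y hYK i hi
  refine ⟨x, ?_⟩
  have : (Y.filter fun j => x ∈ S j) = {i} := by
    ext j
    simp only [Finset.mem_filter, Finset.mem_singleton]
    constructor
    · rintro ⟨hj, hxj⟩; by_contra hji; exact hpriv j hj hji hxj
    · rintro rfl; exact ⟨hi, hx⟩
  rw [this, Finset.card_singleton]; exact odd_one

/-! ### Parameters -/

section WParams

variable (a b c : ℕ)

/-- The threshold weight `W(τ) = τ + 3(aτ+1) + c·((3(aτ+1))!)^b`. -/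
def qwW (τ : ℕ) : ℕ :=
  τ + 3 * (a * τ + 1) + c * Nat.factorial (3 * (a * τ + 1)) ^ b

/-- `τ(n)`: the largest `τ ≤ ⌊log₂ n⌋` with `W(τ) ≤ ⌊log₂ n⌋` (and `0` if there is none). -/
def qwTau (n : ℕ) : ℕ :=
  Nat.findGreatest (fun τ => qwW a b c τ ≤ Nat.log 2 n) (Nat.log 2 n)

/-- `ρ(n) = a·τ(n) + 1`; the rank will be `r = 3ρ`. -/
def qwRho (n : ℕ) : ℕ :=
  a * qwTau a b c n + 1

/-- The number of algebraic functions: `s(n) = n^{2ρ(n) + τ(n)}`. -/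
def qwS (n : ℕ) : ℕ :=
  n ^ (2 * qwRho a b c n + qwTau a b c n)

/-- The number of index bits `L = ⌈log₂ C(n + 3ρ - 1, 3ρ)⌉`. -/
def qwL (n : ℕ) : ℕ :=
  Nat.clog 2 (Nat.choose (n + 3 * qwRho a b c n - 1) (3 * qwRho a b c n))

/-- The degree of the Reed–Muller design: `d = ⌊log_{L+1} n⌋`, so that
`(L+1)^d ≤ n < (L+1)^{d+1}`. -/
def qwD (n : ℕ) : ℕ :=
  Nat.log (qwL a b c n + 1) n

variable (Kf : ℕ → ℕ)

/-- The Reed–Muller design fits (a Boolean test): its `(L+1)^d` positions fit into `Fin n` and its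
order `2^{d+1} - 1` is at least the requested order `Kf (s n)`. -/
def qwFits (n : ℕ) : Bool :=
  decide ((qwL a b c n + 1) ^ qwD a b c n ≤ n) && decide (Kf (qwS a b c n) < 2 ^ (qwD a b c n + 1))

/-- Unfolding the Boolean test. -/
theorem qwFits_iff (n : ℕ) : qwFits a b c Kf n = true ↔
    (qwL a b c n + 1) ^ qwD a b c n ≤ n ∧ Kf (qwS a b c n) < 2 ^ (qwD a b c n + 1) := by
  simp [qwFits]

/-- The rank: `r(n) = 3ρ(n)` when the Reed–Muller design fits, else `1`. -/
def qwR (n : ℕ) : ℕ :=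
  if qwFits a b c Kf n then 3 * qwRho a b c n else 1

/-- The pattern design along `n`: the Reed–Muller design of degree `d(n)` on the
`⌈log₂ C(n+r-1, r)⌉` index bits when it fits, the identity pattern otherwise. -/
def qwPattern (n : ℕ) :
    SoloPattern n (Nat.clog 2 (Nat.choose (n + qwR a b c Kf n - 1) (qwR a b c Kf n))) :=
  if qwFits a b c Kf n then SoloPattern.reedMuller n _ (qwD a b c n) else SoloPattern.idPattern n _

/-- The pattern design has odd witnesses for all nonempty index sets of size `≤ Kf (s n)`. -/
theorem qwPattern_oddWitness (n : ℕ) :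
    ∀ Y : Finset (Fin (Nat.choose (n + qwR a b c Kf n - 1) (qwR a b c Kf n))), Y.Nonempty →
      Y.card ≤ Kf (qwS a b c n) →
        ∃ t : Fin n, Odd (Y.filter fun i : Fin (Nat.choose (n + qwR a b c Kf n - 1)
          (qwR a b c Kf n)) => t ∈ (qwPattern a b c Kf n).S (i : ℕ)).card := by
  by_cases hfit : qwFits a b c Kf n = true
  · have hr : qwR a b c Kf n = 3 * qwRho a b c n := if_pos hfit
    have hD : qwPattern a b c Kf n = SoloPattern.reedMuller n _ (qwD a b c n) := if_pos hfit
    have hf' := (qwFits_iff a b c Kf n).1 hfit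
    rw [hD]
    intro Y hY hYK
    refine SoloPattern.reedMuller_oddWitness ?_ (Nat.le_pow_clog one_lt_two _) Y hY
      (lt_of_le_of_lt hYK hf'.2)
    rw [hr]; exact hf'.1
  · have hr : qwR a b c Kf n = 1 := if_neg hfit
    have hD : qwPattern a b c Kf n = SoloPattern.idPattern n _ := if_neg hfit
    rw [hD]
    have hmeq : Nat.choose (n + qwR a b c Kf n - 1) (qwR a b c Kf n) = n := by rw [hr]; simp
    refine solo_oddWitness_of_privatePoints (K := Kf (qwS a b c n))
      (fun i : Fin _ => (SoloPattern.idPattern n _).S (i : ℕ)) ?_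
    refine SoloPattern.idPattern_privatePoints hmeq.le ?_
    calc n ≤ 2 ^ Nat.clog 2 n := Nat.le_pow_clog one_lt_two n
      _ = _ := by rw [hmeq]

/-- **The design family**: `(Kf (s n), hf (s n))`-designs of `C(n + r(n) - 1, r(n))` subsets of
`Fin n`, for ANY height function `hf`. -/
def qwDesign (hf : ℕ → ℕ) (n : ℕ) :
    SoloDesign (Kf (qwS a b c n)) (hf (qwS a b c n))
      (Nat.choose (n + qwR a b c Kf n - 1) (qwR a b c Kf n)) n :=
  SoloDesign.ofOddWitness (fun i => (qwPattern a b c Kf n).S i) (qwPattern_oddWitness a b c Kf n)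

/-- `⌈log₂ C(n + r(n) - 1, r(n))⌉` is polynomially bounded (indeed `≤ n + r(n) ≤ (3a+4)(n+1)`). -/
theorem qw_clog_isPBounded :
    IsPBounded fun n => Nat.clog 2 (Nat.choose (n + qwR a b c Kf n - 1) (qwR a b c Kf n)) := by
  refine (IsPBounded.iff_exists_le_mul_succ_pow _).2 ⟨3 * a + 4, 1, fun n => ?_⟩
  have hτ : qwTau a b c n ≤ n := (Nat.findGreatest_le _).trans (Nat.log_le_self 2 n)
  have hr : qwR a b c Kf n ≤ 3 * (a * n + 1) := by
    unfold qwR qwRho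
    split_ifs
    · exact Nat.mul_le_mul_left 3 (Nat.add_le_add_right (Nat.mul_le_mul_left a hτ) 1)
    · omega
  calc Nat.clog 2 (Nat.choose (n + qwR a b c Kf n - 1) (qwR a b c Kf n)) ≤ n + qwR a b c Kf n - 1 :=
        Nat.clog_le_of_le_pow (Nat.choose_le_two_pow _ _)
    _ ≤ n + qwR a b c Kf n := Nat.sub_le _ _
    _ ≤ (3 * a + 4) * (n + 1) ^ 1 := by rw [pow_one]; nlinarith [hr]

/-- **Definability** (Raz, Def. 1.3) of the design maps, with an empty Boolean sum. -/
theorem qw_isPolyDefinableMap (hf : ℕ → ℕ) :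
    IsPolyDefinableMap (m := fun n => Nat.choose (n + qwR a b c Kf n - 1) (qwR a b c Kf n))
      (σ := fun n => Fin n) fun n => soloDesignMap (qwDesign a b c Kf hf n).S :=
  soloInformed_isPolyDefinableMap_pattern
    (m := fun n => Nat.choose (n + qwR a b c Kf n - 1) (qwR a b c Kf n))
    (qwPattern a b c Kf) (qw_clog_isPBounded a b c Kf)

/-- Each summand of `W` is at most `W`. -/
theorem qwW_ge (τ : ℕ) :
    τ ≤ qwW a b c τ ∧ 3 * (a * τ + 1) ≤ qwW a b c τ ∧ τ + 3 * (a * τ + 1) ≤ qwW a b c τ ∧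
      c * Nat.factorial (3 * (a * τ + 1)) ^ b ≤ qwW a b c τ := by
  unfold qwW; omega

/-- Once `W(0) ≤ ⌊log₂ n⌋`: `W(τ(n)) ≤ ⌊log₂ n⌋`. -/
theorem qwW_tau_le {n : ℕ} (h0 : qwW a b c 0 ≤ Nat.log 2 n) :
    qwW a b c (qwTau a b c n) ≤ Nat.log 2 n := by
  unfold qwTau
  exact Nat.findGreatest_spec (P := fun τ => qwW a b c τ ≤ Nat.log 2 n) (Nat.zero_le _) h0

/-- `τ(n) ≥ T` as soon as `W(T) ≤ ⌊log₂ n⌋`. -/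
theorem le_qwTau {n T : ℕ} (hT : qwW a b c T ≤ Nat.log 2 n) : T ≤ qwTau a b c n := by
  unfold qwTau
  exact Nat.le_findGreatest (P := fun τ => qwW a b c τ ≤ Nat.log 2 n)
    ((qwW_ge a b c T).1.trans hT) hT

/-- The arithmetic core of the eventual fit: with `t = ⌊log₂ (u+1)⌋`, if `25·C·t² < 2^t`,
`X ≤ (u+1)²`, `M ≤ ((u+1)²)^C` and `2^u < X^{D+1}`, then `M < 2^{D+1}`.  (Otherwise
`D + 1 ≤ (2t+2)·C` and `2^u < X^{D+1} ≤ 2^{(2t+2)²C}`, contradicting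
`(2t+2)²C ≤ 25Ct² < 2^t ≤ u+1`.) -/
private theorem solo_window_core {C T u X M D : ℕ} (hT : ∀ t ≥ T, 25 * C * t ^ 2 < 2 ^ t)
    (hU : 2 ^ T ≤ u + 1) (hu1 : 1 ≤ u) (hXu : X ≤ (u + 1) ^ 2) (hM : M ≤ ((u + 1) ^ 2) ^ C)
    (hD : 2 ^ u < X ^ (D + 1)) : M < 2 ^ (D + 1) := by
  have ht1 : 2 ^ Nat.log 2 (u + 1) ≤ u + 1 := Nat.pow_log_le_self 2 (by omega)
  have ht2 : u + 1 < 2 ^ (Nat.log 2 (u + 1) + 1) := Nat.lt_pow_succ_log_self one_lt_two (u + 1)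
  have hTt : T ≤ Nat.log 2 (u + 1) := Nat.le_log_of_pow_le one_lt_two hU
  have ht_pos : 1 ≤ Nat.log 2 (u + 1) := Nat.le_log_of_pow_le one_lt_two (by rw [pow_one]; omega)
  obtain ⟨t, ht⟩ : ∃ t, t = Nat.log 2 (u + 1) := ⟨_, rfl⟩
  rw [← ht] at ht1 ht2 hTt ht_pos
  have hTt' : 25 * C * t ^ 2 < 2 ^ t := hT t hTt
  have hkey : (2 * t + 2) ^ 2 * C ≤ u := by
    have h1 : (2 * t + 2) ^ 2 ≤ (4 * t) ^ 2 := Nat.pow_le_pow_left (by omega) 2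
    have h2 : (2 * t + 2) ^ 2 * C ≤ 25 * C * t ^ 2 :=
      calc (2 * t + 2) ^ 2 * C ≤ (4 * t) ^ 2 * C := Nat.mul_le_mul_right _ h1
        _ = 16 * C * t ^ 2 := by ring
        _ ≤ 25 * C * t ^ 2 := Nat.mul_le_mul_right _ (Nat.mul_le_mul_right _ (by norm_num))
    omega
  have hu1t : (u + 1) ^ 2 ≤ 2 ^ (2 * t + 2) := by
    have := Nat.pow_le_pow_left ht2.le 2
    rw [← pow_mul] at this
    rw [show 2 * t + 2 = (t + 1) * 2 by ring]; exact this
  have hXt : X ≤ 2 ^ (2 * t + 2) := hXu.trans hu1t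
  have hM' : M ≤ 2 ^ ((2 * t + 2) * C) :=
    calc M ≤ ((u + 1) ^ 2) ^ C := hM
      _ ≤ (2 ^ (2 * t + 2)) ^ C := Nat.pow_le_pow_left hu1t _
      _ = 2 ^ ((2 * t + 2) * C) := (pow_mul _ _ _).symm
  by_contra hcon
  push Not at hcon
  have h1 : 2 ^ (D + 1) ≤ 2 ^ ((2 * t + 2) * C) := hcon.trans hM'
  have h2 : D + 1 ≤ (2 * t + 2) * C := by
    by_contra h2; push Not at h2
    exact absurd (Nat.pow_lt_pow_right one_lt_two h2) (not_lt.2 h1)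
  have hX1 : 1 ≤ X := by
    rcases Nat.eq_zero_or_pos X with h0 | h0
    · rw [h0, zero_pow (by omega)] at hD; exact absurd hD (Nat.not_lt_zero _)
    · exact h0
  have h3 : 2 ^ u < 2 ^ ((2 * t + 2) * ((2 * t + 2) * C)) :=
    calc 2 ^ u < X ^ (D + 1) := hD
      _ ≤ X ^ ((2 * t + 2) * C) := Nat.pow_le_pow_right hX1 h2
      _ ≤ (2 ^ (2 * t + 2)) ^ ((2 * t + 2) * C) := Nat.pow_le_pow_left hXt _
      _ = 2 ^ ((2 * t + 2) * ((2 * t + 2) * C)) := (pow_mul _ _ _).symm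
  have h4 : u < (2 * t + 2) * ((2 * t + 2) * C) := by
    by_contra h4; push Not at h4
    exact absurd (Nat.pow_le_pow_right two_pos h4) (not_le.2 h3)
  have h5 : (2 * t + 2) * ((2 * t + 2) * C) = (2 * t + 2) ^ 2 * C := by ring
  rw [h5] at h4
  exact lt_irrefl _ (h4.trans_le hkey)

/-- **Eventually everything fits.**  If `Kf s ≤ (⌊log₂ s⌋ + 2)^C` for `s ≥ s₁`, then for large `n`:
`n ≥ 1`, the Reed–Muller design fits with order `> Kf (s n)`, and `W(τ(n)) ≤ ⌊log₂ n⌋`.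
The heart is `2^{d+1} > (u+1)^{2C}` (`u = ⌊log₂ n⌋`, `solo_window_core`): otherwise
`n < (L+1)^{d+1} ≤ 2^{(2t+2)^2 C}` with `t = ⌊log₂ (u+1)⌋`, contradicting `2^u ≤ n` once
`(2t+2)^2 C ≤ u`. -/
theorem qw_eventually {Cexp s₁ : ℕ} (hKf : ∀ s, s₁ ≤ s → Kf s ≤ (Nat.log 2 s + 2) ^ Cexp) :
    ∃ n₀ : ℕ, ∀ n ≥ n₀,
      1 ≤ n ∧ qwFits a b c Kf n = true ∧ qwW a b c (qwTau a b c n) ≤ Nat.log 2 n := by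
  obtain ⟨T, hT⟩ := eventually_mul_pow_lt_two_pow 2 (25 * Cexp)
  refine ⟨max s₁ (2 ^ (qwW a b c 0 + 2 ^ T + 2)), fun n hn => ?_⟩
  have h2T : 1 ≤ 2 ^ T := Nat.one_le_two_pow
  have hns₁ : s₁ ≤ n := (le_max_left _ _).trans hn
  have hn2 : 2 ^ (qwW a b c 0 + 2 ^ T + 2) ≤ n := (le_max_right _ _).trans hn
  have hU : qwW a b c 0 + 2 ^ T + 2 ≤ Nat.log 2 n := Nat.le_log_of_pow_le one_lt_two hn2
  have h4n : 2 ^ 2 ≤ n := (Nat.pow_le_pow_right two_pos (by omega)).trans hn2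
  have hn1 : 1 ≤ n := le_trans (by norm_num) h4n
  have hn0 : n ≠ 0 := by omega
  have hW : qwW a b c (qwTau a b c n) ≤ Nat.log 2 n := qwW_tau_le a b c (by omega)
  have hWge := qwW_ge a b c (qwTau a b c n)
  have hρ : qwRho a b c n = a * qwTau a b c n + 1 := rfl
  -- sizes controlled by `u = ⌊log₂ n⌋`
  have h3ρu : 3 * qwRho a b c n ≤ Nat.log 2 n := by rw [hρ]; exact hWge.2.1.trans hW
  have h2ρτ : 2 * qwRho a b c n + qwTau a b c n ≤ Nat.log 2 n := by
    rw [hρ]; have := hWge.2.2.1.trans hW; omega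
  have hm'n : n ≤ Nat.choose (n + 3 * qwRho a b c n - 1) (3 * qwRho a b c n) :=
    solo_le_choose_multiset n (by rw [hρ]; omega)
  have hm'le : Nat.choose (n + 3 * qwRho a b c n - 1) (3 * qwRho a b c n) ≤
      2 ^ ((Nat.log 2 n + 1) * (3 * qwRho a b c n)) :=
    calc Nat.choose (n + 3 * qwRho a b c n - 1) (3 * qwRho a b c n)
        ≤ n ^ (3 * qwRho a b c n) := choose_multiset_le_pow hn1 _
      _ ≤ (2 ^ (Nat.log 2 n + 1)) ^ (3 * qwRho a b c n) :=
          Nat.pow_le_pow_left (Nat.lt_pow_succ_log_self one_lt_two n).le _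
      _ = 2 ^ ((Nat.log 2 n + 1) * (3 * qwRho a b c n)) := (pow_mul _ _ _).symm
  have hL : qwL a b c n ≤ (Nat.log 2 n + 1) * (3 * qwRho a b c n) := Nat.clog_le_of_le_pow hm'le
  have hLu : qwL a b c n ≤ (Nat.log 2 n + 1) * Nat.log 2 n :=
    hL.trans (Nat.mul_le_mul_left _ h3ρu)
  have hL1 : 1 ≤ qwL a b c n :=
    calc 1 = Nat.clog 2 (2 ^ 1) := (Nat.clog_pow 2 1 one_lt_two).symm
      _ ≤ Nat.clog 2 n := Nat.clog_mono_right 2 (by omega)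
      _ ≤ qwL a b c n := Nat.clog_mono_right 2 hm'n
  have hXu : qwL a b c n + 1 ≤ (Nat.log 2 n + 1) ^ 2 :=
    calc qwL a b c n + 1 ≤ (Nat.log 2 n + 1) * Nat.log 2 n + (Nat.log 2 n + 1) := by omega
      _ = (Nat.log 2 n + 1) ^ 2 := by ring
  -- the two logarithms
  have hfit1 : (qwL a b c n + 1) ^ qwD a b c n ≤ n := Nat.pow_log_le_self _ hn0
  have hnlt : n < (qwL a b c n + 1) ^ (qwD a b c n + 1) :=
    Nat.lt_pow_succ_log_self (by omega) n
  have h2u : 2 ^ Nat.log 2 n ≤ n := Nat.pow_log_le_self 2 hn0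
  -- the requested order is below `(u+1)^{2C}`
  have hs₁ : s₁ ≤ qwS a b c n :=
    hns₁.trans (Nat.le_self_pow (by rw [hρ]; omega) n)
  have hSne : qwS a b c n ≠ 0 := (pow_pos (by omega) _).ne'
  have hlogS : Nat.log 2 (qwS a b c n) <
      (Nat.log 2 n + 1) * (2 * qwRho a b c n + qwTau a b c n) := by
    refine Nat.log_lt_of_lt_pow hSne ?_
    rw [pow_mul]
    exact Nat.pow_lt_pow_left (Nat.lt_pow_succ_log_self one_lt_two n) (by rw [hρ]; omega)
  have hlogS' : Nat.log 2 (qwS a b c n) + 2 ≤ (Nat.log 2 n + 1) ^ 2 := by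
    have h1 := Nat.mul_le_mul_left (Nat.log 2 n + 1) h2ρτ
    calc Nat.log 2 (qwS a b c n) + 2 ≤ (Nat.log 2 n + 1) * Nat.log 2 n + (Nat.log 2 n + 1) := by
          omega
      _ = (Nat.log 2 n + 1) ^ 2 := by ring
  have hKfM : Kf (qwS a b c n) ≤ ((Nat.log 2 n + 1) ^ 2) ^ Cexp :=
    (hKf _ hs₁).trans (Nat.pow_le_pow_left hlogS' _)
  have hfit2 : Kf (qwS a b c n) < 2 ^ (qwD a b c n + 1) :=
    solo_window_core hT (by omega) (by omega) hXu hKfM (lt_of_le_of_lt h2u hnlt)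
  exact ⟨hn1, (qwFits_iff a b c Kf n).2 ⟨hfit1, hfit2⟩, hW⟩

end WParams

end Summit.ValiantsHypothesis.ValiantsHypothesis.Theorems

end
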